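import Mathlib.NumberTheory.NumberField.InfinitePlace.TotallyRealComplex
import Mathlib.NumberTheory.NumberField.Norm
import Mathlib.NumberTheory.NumberField.Basic
import Mathlib.Analysis.Complex.Basic
import HarnessLib

/-!
# A complex embedding of an imaginary quadratic field: norms, discreteness, lattice points

Topic `NumberTheory/NumberFields`; namespace `Literature.NumberTheory.NumberFields`, grouping
sub-namespace `ImaginaryQuadratic`.  Theorems only (Mathlib only; no definition, no named fact,
no instance, no `sorry`).

Let `K` be an IMAGINARY QUADRATIC field (`IsTotallyComplex K`, `finrank ℚ K = 2`) and
`σ : K →+* ℂ` a complex embedding ([ElstrodtGrunewaldMennicke1998, Ch. 7 §7.1]: `𝓞_K ⊂ ℂ` is a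
lattice, `N(x) = |x|²`).  Then `K` has a single infinite place, of multiplicity `2`, so the
infinite part of the product formula (Mathlib `InfinitePlace.prod_eq_abs_norm`) reads

* `norm_sq_eq_abs_norm` — **`‖σ x‖² = |N_{K/ℚ}(x)|`** for `x ∈ K`; hence for algebraic integers
  `one_le_norm_of_ne_zero` (`‖σ x‖ ≥ 1`, `x ≠ 0`), `norm_eq_one_of_isUnit` (units have absolute
  value `1`) and `norm_sq_eq_natAbs_norm`;
* `finite_setOf_norm_le` — **discreteness**: `{x ∈ 𝓞_K | ‖σ x‖ ≤ B}` is finite (points of `σ(𝓞_K)`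
  are `1`-separated; compare half-integer parts);
* `exists_im_ne_zero` — there is `ω ∈ 𝓞_K` with `σ ω ∉ ℝ`, and `exists_norm_sub_le` — **covering
  radius**: every `w ∈ ℂ` is within `(1 + ‖σ ω‖)/2` of some `σ x`, `x ∈ 𝓞_K` (round the two real
  coordinates in the basis `1, σ ω`).

## References

* J. Elstrodt, F. Grunewald, J. Mennicke, *Groups Acting on Hyperbolic Space* (1998), Ch. 7 §7.1
  [ElstrodtGrunewaldMennicke1998].
-/

noncomputable section

open NumberField NumberField.InfinitePlace Complex
open scoped ComplexConjugate

namespace Literature.NumberTheory.NumberFields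

namespace ImaginaryQuadratic

variable {K : Type*} [Field K] [NumberField K] [IsTotallyComplex K]

/-- An imaginary quadratic field has exactly one infinite place. [folklore] -/
theorem card_infinitePlace (hK : Module.finrank ℚ K = 2) : Fintype.card (InfinitePlace K) = 1 := by
  have h1 := IsTotallyComplex.finrank (K := K)
  have h2 := card_eq_nrRealPlaces_add_nrComplexPlaces (K := K)
  rw [IsTotallyComplex.nrRealPlaces_eq_zero, zero_add] at h2
  omega

/-- All infinite places of an imaginary quadratic field coincide. [folklore] -/
theorem infinitePlace_eq (hK : Module.finrank ℚ K = 2) (w w' : InfinitePlace K) : w = w' :=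
  (Fintype.card_le_one_iff.1 (card_infinitePlace hK).le) w w'

/-- **`‖σ x‖² = |N_{K/ℚ}(x)|`** for a complex embedding `σ` of an imaginary quadratic field (the
infinite part of the product formula with a single place of multiplicity `2`).
[cite: ElstrodtGrunewaldMennicke1998, Ch. 7 §7.1] -/
theorem norm_sq_eq_abs_norm (hK : Module.finrank ℚ K = 2) (σ : K →+* ℂ) (x : K) :
    ‖σ x‖ ^ 2 = |(Algebra.norm ℚ x : ℚ)| := by
  have h := prod_eq_abs_norm x
  have huniv : (Finset.univ : Finset (InfinitePlace K)) = {InfinitePlace.mk σ} :=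
    Finset.eq_singleton_iff_unique_mem.2 ⟨Finset.mem_univ _, fun w _ => infinitePlace_eq hK w _⟩
  rw [huniv, Finset.prod_singleton, IsTotallyComplex.mult_eq, InfinitePlace.apply] at h
  rw [h, Rat.cast_abs]

/-- For an algebraic integer, `‖σ x‖² = |N(x)|` with the integral norm. [folklore] -/
theorem norm_sq_eq_natAbs_norm (hK : Module.finrank ℚ K = 2) (σ : K →+* ℂ) (x : 𝓞 K) :
    ‖σ x‖ ^ 2 = ((Algebra.norm ℤ x).natAbs : ℝ) := by
  rw [norm_sq_eq_abs_norm hK σ (x : K), ← Algebra.coe_norm_int, ← Int.cast_abs, Rat.cast_intCast,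
    Int.abs_eq_natAbs, Int.cast_natCast]

/-- **A non-zero algebraic integer has absolute value at least `1`** under `σ`. [folklore] -/
theorem one_le_norm_of_ne_zero (hK : Module.finrank ℚ K = 2) (σ : K →+* ℂ) {x : 𝓞 K} (hx : x ≠ 0) :
    1 ≤ ‖σ x‖ := by
  have h := norm_sq_eq_natAbs_norm hK σ x
  have hn : (Algebra.norm ℤ x).natAbs ≠ 0 := by
    rw [Ne, Int.natAbs_eq_zero, Algebra.norm_eq_zero_iff]
    exact hx
  have h1 : (1 : ℝ) ≤ ((Algebra.norm ℤ x).natAbs : ℝ) := by exact_mod_cast Nat.one_le_iff_ne_zero.2 hn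
  nlinarith [norm_nonneg (σ x)]

/-- **Units have absolute value `1`** under `σ`. [folklore] -/
theorem norm_eq_one_of_isUnit (hK : Module.finrank ℚ K = 2) (σ : K →+* ℂ) {x : 𝓞 K} (hx : IsUnit x) :
    ‖σ x‖ = 1 := by
  have h := norm_sq_eq_natAbs_norm hK σ x
  have hn : (Algebra.norm ℤ x).natAbs = 1 := Int.isUnit_iff_natAbs_eq.1 (hx.map (Algebra.norm ℤ))
  rw [hn, Nat.cast_one] at h
  have h0 := norm_nonneg (σ x)
  nlinarith

/-- Distinct algebraic integers are at distance at least `1` under `σ`. [folklore] -/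
theorem one_le_norm_sub (hK : Module.finrank ℚ K = 2) (σ : K →+* ℂ) {x y : 𝓞 K} (hxy : x ≠ y) :
    1 ≤ ‖σ x - σ y‖ := by
  have h := one_le_norm_of_ne_zero hK σ (sub_ne_zero.2 hxy)
  rwa [RingOfIntegers.coe_eq_algebraMap, map_sub, map_sub] at h

/-- **Discreteness of `σ(𝓞_K)`**: only finitely many algebraic integers have `‖σ x‖ ≤ B`
(two of them with the same half-integer parts of real and imaginary part are closer than `1`).
[cite: ElstrodtGrunewaldMennicke1998, Ch. 7 §7.1] -/
theorem finite_setOf_norm_le (hK : Module.finrank ℚ K = 2) (σ : K →+* ℂ) (B : ℝ) :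
    {x : 𝓞 K | ‖σ x‖ ≤ B}.Finite := by
  -- the grid map
  let f : 𝓞 K → ℤ × ℤ := fun x => (⌊2 * (σ x).re⌋, ⌊2 * (σ x).im⌋)
  have hinj : Set.InjOn f {x : 𝓞 K | ‖σ x‖ ≤ B} := by
    intro x _ y _ hxy
    by_contra hne
    have h1 := one_le_norm_sub hK σ hne
    simp only [f, Prod.mk.injEq] at hxy
    have hre : |(σ x).re - (σ y).re| < 1 / 2 := by
      have := Int.abs_sub_lt_one_of_floor_eq_floor hxy.1
      rw [← mul_sub, abs_mul, abs_two] at this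
      linarith
    have him : |(σ x).im - (σ y).im| < 1 / 2 := by
      have := Int.abs_sub_lt_one_of_floor_eq_floor hxy.2
      rw [← mul_sub, abs_mul, abs_two] at this
      linarith
    have hle : ‖σ x - σ y‖ ≤ |(σ x - σ y).re| + |(σ x - σ y).im| := Complex.norm_le_abs_re_add_abs_im _
    rw [Complex.sub_re, Complex.sub_im] at hle
    linarith
  have hbdd : f '' {x : 𝓞 K | ‖σ x‖ ≤ B} ⊆
      (Finset.Icc (⌊-(2 * B)⌋ - 1) (⌈2 * B⌉ + 1) ×ˢ Finset.Icc (⌊-(2 * B)⌋ - 1) (⌈2 * B⌉ + 1) :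
        Finset (ℤ × ℤ)) := by
    rintro _ ⟨x, hx, rfl⟩
    have hre : |(σ x).re| ≤ B := (Complex.abs_re_le_norm _).trans hx
    have him : |(σ x).im| ≤ B := (Complex.abs_im_le_norm _).trans hx
    rw [abs_le] at hre him
    simp only [Finset.coe_product, Finset.coe_Icc, Set.mem_prod, Set.mem_Icc, f]
    refine ⟨⟨?_, ?_⟩, ?_, ?_⟩
    · have : ⌊-(2 * B)⌋ ≤ ⌊2 * (σ x).re⌋ := Int.floor_le_floor (by linarith)
      omega
    · have : ⌊2 * (σ x).re⌋ ≤ ⌈2 * B⌉ := Int.floor_le_ceil _ |>.trans (Int.ceil_le_ceil (by linarith))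
      omega
    · have : ⌊-(2 * B)⌋ ≤ ⌊2 * (σ x).im⌋ := Int.floor_le_floor (by linarith)
      omega
    · have : ⌊2 * (σ x).im⌋ ≤ ⌈2 * B⌉ := Int.floor_le_ceil _ |>.trans (Int.ceil_le_ceil (by linarith))
      omega
  exact Set.Finite.of_finite_image ((Finset.finite_toSet _).subset hbdd) hinj

/-- There is an algebraic integer whose image is not real (`σ` is not a real embedding).
[cite: ElstrodtGrunewaldMennicke1998, Ch. 7 §7.1] -/
theorem exists_im_ne_zero (σ : K →+* ℂ) : ∃ ω : 𝓞 K, (σ ω).im ≠ 0 := by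
  by_contra h
  have h' : ∀ ω : 𝓞 K, (σ ω).im = 0 := fun ω => by
    by_contra hω
    exact h ⟨ω, hω⟩
  apply IsTotallyComplex.complexEmbedding_not_isReal (K := K) σ
  rw [ComplexEmbedding.isReal_iff]
  refine RingHom.ext fun k => ?_
  rw [ComplexEmbedding.conjugate_coe_eq, Complex.conj_eq_iff_im]
  obtain ⟨a, b, hb, rfl⟩ := IsFractionRing.div_surjective (A := 𝓞 K) k
  rw [map_div₀, Complex.div_im, ← RingOfIntegers.coe_eq_algebraMap, ← RingOfIntegers.coe_eq_algebraMap,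
    h' a, h' b]
  simp

omit [IsTotallyComplex K] in
/-- **Covering radius of `σ(𝓞_K)` in `ℂ`**: with `ω ∈ 𝓞_K`, `Im σ ω ≠ 0`, every complex number is
within `(1 + ‖σ ω‖)/2` of `σ x` for some `x ∈ 𝓞_K` (round the coordinates in the real basis
`1, σ ω`). [cite: ElstrodtGrunewaldMennicke1998, Ch. 7 §7.1] -/
theorem exists_norm_sub_le (σ : K →+* ℂ) {ω : 𝓞 K} (hω : (σ ω).im ≠ 0) (w : ℂ) :
    ∃ x : 𝓞 K, ‖w - σ x‖ ≤ (1 + ‖σ (ω : K)‖) / 2 := by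
  -- coordinates `w = s + t σω`
  set t : ℝ := w.im / (σ ω).im with ht
  set s : ℝ := w.re - t * (σ ω).re with hs
  have hw : w = (s : ℂ) + (t : ℂ) * σ ω := by
    apply Complex.ext
    · simp [hs]
    · simp only [Complex.add_im, Complex.ofReal_im, Complex.mul_im, Complex.ofReal_re, zero_mul,
        add_zero, zero_add, ht]
      field_simp
  refine ⟨round s + round t * ω, ?_⟩
  have hx : (σ ((round s + round t * ω : 𝓞 K) : K) : ℂ) = (round s : ℝ) + ((round t : ℝ) : ℂ) * σ ω := by
    push_cast
    simp [map_add, map_mul]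
  rw [hw, hx]
  have hrw : (s : ℂ) + (t : ℂ) * σ ω - ((round s : ℝ) + ((round t : ℝ) : ℂ) * σ ω) =
      ((s - round s : ℝ) : ℂ) + ((t - round t : ℝ) : ℂ) * σ ω := by
    push_cast
    ring
  rw [hrw]
  calc ‖((s - round s : ℝ) : ℂ) + ((t - round t : ℝ) : ℂ) * σ ω‖
      ≤ ‖((s - round s : ℝ) : ℂ)‖ + ‖((t - round t : ℝ) : ℂ) * σ ω‖ := norm_add_le _ _
    _ = |s - round s| + |t - round t| * ‖σ (ω : K)‖ := by
        rw [norm_mul, Complex.norm_real, Complex.norm_real, Real.norm_eq_abs, Real.norm_eq_abs]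
    _ ≤ 1 / 2 + 1 / 2 * ‖σ (ω : K)‖ := by
        gcongr
        · exact abs_sub_round s
        · exact abs_sub_round t
    _ = (1 + ‖σ (ω : K)‖) / 2 := by ring

end ImaginaryQuadratic

end Literature.NumberTheory.NumberFields
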